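import Literature.Analysis.FluidPDE.TaoClassQuotientBalance
import Literature.Analysis.FluidPDE.RadialQuotientSobolev
import HarnessLib

/-!
# Square-integrability data of the Hou–Li quotients along a Tao-class axisymmetric solution

Analysis/FluidPDE support file (theorems only; no definitions, no named facts) on the discharge
path of the named fact `Literature.Analysis.FluidPDE.LeiZhang2017_logModulus_regularity`
(Lei–Zhang 2017, arXiv:1505.02628, Cor. 1.3): the fixed-time inequality
`LeiZhang2017.slice_inequality` asks, at a time `t`, for `L²`-membership of
`Ω = angVortQuot (v t)`, `J = radVelQuot (curl (v t))`, `W = radVelQuot (v t)` and of their first,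
second (and for `W` third) directional derivatives and ray-average quotients, plus bounds
`‖v t‖ ≤ B`, `‖D(v t)‖ ≤ B'` and `v t, D(v t) ∈ L²`. Along a Tao-class solution
(`IsTaoSolutionOn T ν u₀ v q`) with axisymmetric slices all of these hold uniformly on `[0, T]`
(Sobolev bounds of the quotient families, `AxisymQuotientRayAverage`; `memLp_radDerivQuot_of_memLp`):

* `IsTaoSolutionOn.exists_bound_fderiv_velocity`, `…integrable_norm_sq`, `…integrable_norm_fderiv_sq`;
* `IsTaoSolutionOn.memLp_angVortQuot_data`, `…memLp_radVelQuot_curl_data`, `…memLp_radVelQuot_data`.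

## References

* Z. Lei, Q. S. Zhang, Pacific J. Math. 289 (2017) 169–187, arXiv:1505.02628, §3. [`LeiZhang2017`]
* T. Tao, Localisation and compactness …, Anal. PDE 6 (2013), §4 (the solution class).
-/

noncomputable section

open MeasureTheory Set Function Filter Topology InnerProductSpace WithLp
open scoped RealInnerProductSpace ContDiff ENNReal NNReal Topology

namespace Literature.Analysis.FluidPDE

/-! ### Pointwise bounds of directional derivatives by iterated derivatives -/

section Pointwise

variable {G : Type*} [NormedAddCommGroup G] [NormedSpace ℝ G] {f : EuclideanSpace ℝ (Fin 3) → G}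

/-- `‖∂ᵢf(x)‖ ≤ ‖D¹f(x)‖`. [folklore] -/
theorem norm_fderiv_apply_single_le_iteratedFDeriv (f : EuclideanSpace ℝ (Fin 3) → G)
    (x : EuclideanSpace ℝ (Fin 3)) (i : Fin 3) :
    ‖fderiv ℝ f x (EuclideanSpace.single i 1)‖ ≤ ‖iteratedFDeriv ℝ 1 f x‖ := by
  have h := norm_fderiv_apply_basisFun_le f x i
  simpa using h

/-- `‖∂ⱼ∂ᵢf(x)‖ ≤ ‖D²f(x)‖` for `f ∈ C²`. [folklore] -/
theorem norm_fderiv_fderiv_apply_single_le_iteratedFDeriv (hf : ContDiff ℝ 2 f)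
    (x : EuclideanSpace ℝ (Fin 3)) (i j : Fin 3) :
    ‖fderiv ℝ (fun y => fderiv ℝ f y (EuclideanSpace.single i 1)) x (EuclideanSpace.single j 1)‖ ≤
      ‖iteratedFDeriv ℝ 2 f x‖ := by
  set g : EuclideanSpace ℝ (Fin 3) → G := fun y => fderiv ℝ f y (EuclideanSpace.single i 1)
  have h1 : ‖fderiv ℝ g x (EuclideanSpace.single j 1)‖ ≤ ‖iteratedFDeriv ℝ 1 g x‖ :=
    norm_fderiv_apply_single_le_iteratedFDeriv g x j
  have hD : ContDiff ℝ 1 (fderiv ℝ f) := hf.fderiv_right (m := 1) (by norm_cast)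
  have h2 : ‖iteratedFDeriv ℝ 1 g x‖ ≤ ‖(EuclideanSpace.single i 1 : EuclideanSpace ℝ (Fin 3))‖ *
      ‖iteratedFDeriv ℝ 1 (fderiv ℝ f) x‖ :=
    norm_iteratedFDeriv_clm_apply_const hD.contDiffAt le_rfl
  rw [norm_iteratedFDeriv_fderiv] at h2
  have h3 : ‖(EuclideanSpace.single i 1 : EuclideanSpace ℝ (Fin 3))‖ = 1 := by simp
  rw [h3, one_mul] at h2
  exact h1.trans h2

/-- `‖∂ₖ∂ⱼ∂ᵢf(x)‖ ≤ ‖D³f(x)‖` for `f ∈ C³`. [folklore] -/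
theorem norm_fderiv3_apply_single_le_iteratedFDeriv (hf : ContDiff ℝ 3 f)
    (x : EuclideanSpace ℝ (Fin 3)) (i j k : Fin 3) :
    ‖fderiv ℝ (fun y => fderiv ℝ (fun z => fderiv ℝ f z (EuclideanSpace.single i 1)) y
      (EuclideanSpace.single j 1)) x (EuclideanSpace.single k 1)‖ ≤ ‖iteratedFDeriv ℝ 3 f x‖ := by
  set g : EuclideanSpace ℝ (Fin 3) → G := fun y => fderiv ℝ f y (EuclideanSpace.single i 1)
  have hD : ContDiff ℝ 2 (fderiv ℝ f) := hf.fderiv_right (m := 2) (by norm_cast)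
  have hg : ContDiff ℝ 2 g := hD.clm_apply contDiff_const
  have h1 := norm_fderiv_fderiv_apply_single_le_iteratedFDeriv hg x j k
  have h2 : ‖iteratedFDeriv ℝ 2 g x‖ ≤ ‖(EuclideanSpace.single i 1 : EuclideanSpace ℝ (Fin 3))‖ *
      ‖iteratedFDeriv ℝ 2 (fderiv ℝ f) x‖ :=
    norm_iteratedFDeriv_clm_apply_const hD.contDiffAt le_rfl
  rw [norm_iteratedFDeriv_fderiv] at h2
  have h3 : ‖(EuclideanSpace.single i 1 : EuclideanSpace ℝ (Fin 3))‖ = 1 := by simp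
  rw [h3, one_mul] at h2
  exact h1.trans h2

omit [NormedSpace ℝ G] in
/-- A continuous function dominated pointwise by a function with `∫ ‖F‖² ≤ C < ∞` is in `L²`.
[folklore] -/
theorem memLp_two_of_norm_le_coe {F : EuclideanSpace ℝ (Fin 3) → G} {g : EuclideanSpace ℝ (Fin 3) → ℝ}
    (hg : Continuous g) (hle : ∀ x, ‖g x‖ ≤ ‖F x‖) {C : ℝ≥0} (hF : ∫⁻ x, ‖F x‖ₑ ^ 2 ≤ C) :
    MemLp g 2 volume := by
  refine memLp_two_of_lintegral_sq_le_coe hg ((lintegral_mono fun x => ?_).trans hF)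
  gcongr
  rw [← ofReal_norm, ← ofReal_norm]
  exact ENNReal.ofReal_le_ofReal (hle x)

end Pointwise

/-! ### The data along a Tao-class solution -/

section Data

variable {T ν : ℝ} {u₀ : EuclideanSpace ℝ (Fin 3) → EuclideanSpace ℝ (Fin 3)}
  {v : ℝ → EuclideanSpace ℝ (Fin 3) → EuclideanSpace ℝ (Fin 3)} {q : ℝ → EuclideanSpace ℝ (Fin 3) → ℝ}

/-- The derivative of a Tao-class velocity is bounded on the slab. [folklore] -/
theorem IsTaoSolutionOn.exists_bound_fderiv_velocity (h : IsTaoSolutionOn T ν u₀ v q) :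
    ∃ B' : ℝ, 0 ≤ B' ∧ ∀ t ∈ Icc 0 T, ∀ x, ‖fderiv ℝ (v t) x‖ ≤ B' := by
  obtain ⟨B', hB'0, hB'⟩ := h.sobolev.exists_forall_norm_iteratedFDeriv_le
    (fun t ht => h.classical.contDiff_velocity ht) 1
  refine ⟨B', hB'0, fun t ht x => ?_⟩
  rw [← norm_iteratedFDeriv_zero (𝕜 := ℝ) (f := fderiv ℝ (v t)), norm_iteratedFDeriv_fderiv]
  exact hB' t ht x

/-- `v(t) ∈ L²` (square-integrable norm) along a Tao-class solution. [folklore] -/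
theorem IsTaoSolutionOn.integrable_norm_sq (h : IsTaoSolutionOn T ν u₀ v q) {t : ℝ} (ht : t ∈ Icc 0 T) :
    Integrable (fun x => ‖v t x‖ ^ 2) := by
  obtain ⟨C, hC⟩ := h.sobolev 0
  have hm : MemLp (v t) 2 volume := by
    refine ⟨(h.classical.contDiff_velocity ht).continuous.aestronglyMeasurable,
      eLpNorm_two_lt_top_of_lintegral_enorm_sq_lt_top ?_⟩
    have e : ∫⁻ x, ‖v t x‖ₑ ^ 2 = ∫⁻ x, ‖iteratedFDeriv ℝ 0 (v t) x‖ₑ ^ 2 :=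
      lintegral_congr fun x => by rw [← ofReal_norm, ← ofReal_norm, norm_iteratedFDeriv_zero]
    rw [e]; exact (hC t ht).trans_lt ENNReal.coe_lt_top
  exact (memLp_two_iff_integrable_sq_norm hm.1).1 hm

/-- `D v(t) ∈ L²` (square-integrable operator norm) along a Tao-class solution. [folklore] -/
theorem IsTaoSolutionOn.integrable_norm_fderiv_sq (h : IsTaoSolutionOn T ν u₀ v q) {t : ℝ}
    (ht : t ∈ Icc 0 T) : Integrable (fun x => ‖fderiv ℝ (v t) x‖ ^ 2) := by
  obtain ⟨C, hC⟩ := h.sobolev 1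
  have hv := h.classical.contDiff_velocity ht
  have hm : MemLp (fderiv ℝ (v t)) 2 volume := by
    refine ⟨(hv.continuous_fderiv (by simp)).aestronglyMeasurable,
      eLpNorm_two_lt_top_of_lintegral_enorm_sq_lt_top ?_⟩
    have e : ∫⁻ x, ‖fderiv ℝ (v t) x‖ₑ ^ 2 = ∫⁻ x, ‖iteratedFDeriv ℝ 1 (v t) x‖ₑ ^ 2 :=
      lintegral_congr fun x => by
        rw [← ofReal_norm, ← ofReal_norm, ← norm_iteratedFDeriv_zero (𝕜 := ℝ) (f := fderiv ℝ (v t)),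
          norm_iteratedFDeriv_fderiv]
    rw [e]; exact (hC t ht).trans_lt ENNReal.coe_lt_top
  exact (memLp_two_iff_integrable_sq_norm hm.1).1 hm

/-- **`L²` data of `Ω = angVortQuot (v t)`** along a Tao-class solution with axisymmetric slices:
`Ω, ∂ᵢΩ, ∂ᵢ∂ᵢΩ, radDerivQuot Ω ∈ L²`. [folklore] -/
theorem IsTaoSolutionOn.memLp_angVortQuot_data (h : IsTaoSolutionOn T ν u₀ v q)
    (hax : ∀ t ∈ Icc 0 T, IsAxisymmetric (v t)) {t : ℝ} (ht : t ∈ Icc 0 T) :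
    MemLp (angVortQuot (v t)) 2 volume ∧
    (∀ i : Fin 3, MemLp (fun x => fderiv ℝ (angVortQuot (v t)) x (EuclideanSpace.single i 1)) 2 volume) ∧
    (∀ i : Fin 3, MemLp (fun x => fderiv ℝ (fun y => fderiv ℝ (angVortQuot (v t)) y
      (EuclideanSpace.single i 1)) x (EuclideanSpace.single i 1)) 2 volume) ∧
    MemLp (radDerivQuot (angVortQuot (v t))) 2 volume := by
  have hvs : ∀ s ∈ Icc 0 T, ContDiff ℝ ∞ (v s) := fun s hs => h.classical.contDiff_velocity hs
  obtain ⟨C0, hC0⟩ := exists_lintegral_sq_iteratedFDeriv_angVortQuot_le hvs hax h.sobolev 0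
  obtain ⟨C1, hC1⟩ := exists_lintegral_sq_iteratedFDeriv_angVortQuot_le hvs hax h.sobolev 1
  obtain ⟨C2, hC2⟩ := exists_lintegral_sq_iteratedFDeriv_angVortQuot_le hvs hax h.sobolev 2
  set Ω := angVortQuot (v t) with hΩ
  have hΩc : ContDiff ℝ ∞ Ω := contDiff_angVortQuot (by simpa using hvs t ht)
  have hΩ2 : ContDiff ℝ 2 Ω := hΩc.of_le (by norm_cast)
  have hΩ1 : ContDiff ℝ 1 Ω := hΩc.of_le (by norm_cast)
  have m0 : MemLp Ω 2 volume :=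
    memLp_two_of_norm_le_coe (F := fun x => iteratedFDeriv ℝ 0 Ω x) hΩc.continuous
      (fun x => by rw [norm_iteratedFDeriv_zero]) (hC0 t ht)
  have m1 : ∀ i : Fin 3, MemLp (fun x => fderiv ℝ Ω x (EuclideanSpace.single i 1)) 2 volume := fun i =>
    memLp_two_of_norm_le_coe (F := fun x => iteratedFDeriv ℝ 1 Ω x)
      ((hΩ1.continuous_fderiv one_ne_zero).clm_apply continuous_const)
      (fun x => norm_fderiv_apply_single_le_iteratedFDeriv Ω x i) (hC1 t ht)
  have m2 : ∀ i : Fin 3, MemLp (fun x => fderiv ℝ (fun y => fderiv ℝ Ω y (EuclideanSpace.single i 1)) x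
      (EuclideanSpace.single i 1)) 2 volume := fun i =>
    memLp_two_of_norm_le_coe (F := fun x => iteratedFDeriv ℝ 2 Ω x)
      (((contDiff_fderiv_apply_const_succ (n := 1) (by exact_mod_cast hΩ2) _).continuous_fderiv
        one_ne_zero).clm_apply continuous_const)
      (fun x => norm_fderiv_fderiv_apply_single_le_iteratedFDeriv hΩ2 x i i) (hC2 t ht)
  exact ⟨m0, m1, m2, (memLp_radDerivQuot_of_memLp hΩ2 (m2 0)).1⟩

/-- **`L²` data of `J = radVelQuot (curl (v t))`** along a Tao-class solution with axisymmetric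
slices: `J, ∂ᵢJ, ∂ᵢ∂ᵢJ, radDerivQuot J ∈ L²`. [folklore] -/
theorem IsTaoSolutionOn.memLp_radVelQuot_curl_data (h : IsTaoSolutionOn T ν u₀ v q)
    (hax : ∀ t ∈ Icc 0 T, IsAxisymmetric (v t)) {t : ℝ} (ht : t ∈ Icc 0 T) :
    MemLp (radVelQuot (curl (v t))) 2 volume ∧
    (∀ i : Fin 3, MemLp (fun x => fderiv ℝ (radVelQuot (curl (v t))) x (EuclideanSpace.single i 1)) 2 volume) ∧
    (∀ i : Fin 3, MemLp (fun x => fderiv ℝ (fun y => fderiv ℝ (radVelQuot (curl (v t))) y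
      (EuclideanSpace.single i 1)) x (EuclideanSpace.single i 1)) 2 volume) ∧
    MemLp (radDerivQuot (radVelQuot (curl (v t)))) 2 volume := by
  have hvs : ∀ s ∈ Icc 0 T, ContDiff ℝ ∞ (v s) := fun s hs => h.classical.contDiff_velocity hs
  have hcs : ∀ s ∈ Icc 0 T, ContDiff ℝ ∞ (curl (v s)) := fun s hs => by
    rw [curl_eq_curlCLM_comp]; exact curlCLM.contDiff.comp ((hvs s hs).fderiv_right (m := ∞) (by simp))
  have hcax : ∀ s ∈ Icc 0 T, IsAxisymmetric (curl (v s)) := fun s hs =>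
    (hax s hs).curl ((hvs s hs).differentiable (by simp))
  have hH := hasBoundedSobolevNormsOn_curl h.sobolev hvs
  obtain ⟨C0, hC0⟩ := exists_lintegral_sq_iteratedFDeriv_radVelQuot_le hcs hcax hH 0
  obtain ⟨C1, hC1⟩ := exists_lintegral_sq_iteratedFDeriv_radVelQuot_le hcs hcax hH 1
  obtain ⟨C2, hC2⟩ := exists_lintegral_sq_iteratedFDeriv_radVelQuot_le hcs hcax hH 2
  set J := radVelQuot (curl (v t)) with hJ
  have hJc : ContDiff ℝ ∞ J := contDiff_radVelQuot (by simpa using hcs t ht)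
  have hJ2 : ContDiff ℝ 2 J := hJc.of_le (by norm_cast)
  have hJ1 : ContDiff ℝ 1 J := hJc.of_le (by norm_cast)
  have m0 : MemLp J 2 volume :=
    memLp_two_of_norm_le_coe (F := fun x => iteratedFDeriv ℝ 0 J x) hJc.continuous
      (fun x => by rw [norm_iteratedFDeriv_zero]) (hC0 t ht)
  have m1 : ∀ i : Fin 3, MemLp (fun x => fderiv ℝ J x (EuclideanSpace.single i 1)) 2 volume := fun i =>
    memLp_two_of_norm_le_coe (F := fun x => iteratedFDeriv ℝ 1 J x)
      ((hJ1.continuous_fderiv one_ne_zero).clm_apply continuous_const)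
      (fun x => norm_fderiv_apply_single_le_iteratedFDeriv J x i) (hC1 t ht)
  have m2 : ∀ i : Fin 3, MemLp (fun x => fderiv ℝ (fun y => fderiv ℝ J y (EuclideanSpace.single i 1)) x
      (EuclideanSpace.single i 1)) 2 volume := fun i =>
    memLp_two_of_norm_le_coe (F := fun x => iteratedFDeriv ℝ 2 J x)
      (((contDiff_fderiv_apply_const_succ (n := 1) (by exact_mod_cast hJ2) _).continuous_fderiv
        one_ne_zero).clm_apply continuous_const)
      (fun x => norm_fderiv_fderiv_apply_single_le_iteratedFDeriv hJ2 x i i) (hC2 t ht)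
  exact ⟨m0, m1, m2, (memLp_radDerivQuot_of_memLp hJ2 (m2 0)).1⟩

/-- **`L²` data of `W = radVelQuot (v t)`** along a Tao-class solution with axisymmetric slices:
`∂ᵢW, ∂ⱼ∂ᵢW, ∂ⱼ∂ⱼ∂ᵢW, radDerivQuot W, radDerivQuot (∂₂W) ∈ L²`. [folklore] -/
theorem IsTaoSolutionOn.memLp_radVelQuot_data (h : IsTaoSolutionOn T ν u₀ v q)
    (hax : ∀ t ∈ Icc 0 T, IsAxisymmetric (v t)) {t : ℝ} (ht : t ∈ Icc 0 T) :
    (∀ i : Fin 3, MemLp (fun x => fderiv ℝ (radVelQuot (v t)) x (EuclideanSpace.single i 1)) 2 volume) ∧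
    (∀ i j : Fin 3, MemLp (fun x => fderiv ℝ (fun y => fderiv ℝ (radVelQuot (v t)) y
      (EuclideanSpace.single i 1)) x (EuclideanSpace.single j 1)) 2 volume) ∧
    (∀ i j : Fin 3, MemLp (fun x => fderiv ℝ (fun y => fderiv ℝ (fun z => fderiv ℝ (radVelQuot (v t)) z
      (EuclideanSpace.single i 1)) y (EuclideanSpace.single j 1)) x (EuclideanSpace.single j 1)) 2 volume) ∧
    MemLp (radDerivQuot (radVelQuot (v t))) 2 volume ∧
    MemLp (radDerivQuot fun y => fderiv ℝ (radVelQuot (v t)) y (EuclideanSpace.single 2 1)) 2 volume := by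
  have hvs : ∀ s ∈ Icc 0 T, ContDiff ℝ ∞ (v s) := fun s hs => h.classical.contDiff_velocity hs
  obtain ⟨C1, hC1⟩ := exists_lintegral_sq_iteratedFDeriv_radVelQuot_le hvs hax h.sobolev 1
  obtain ⟨C2, hC2⟩ := exists_lintegral_sq_iteratedFDeriv_radVelQuot_le hvs hax h.sobolev 2
  obtain ⟨C3, hC3⟩ := exists_lintegral_sq_iteratedFDeriv_radVelQuot_le hvs hax h.sobolev 3
  set W := radVelQuot (v t) with hW
  have hWc : ContDiff ℝ ∞ W := contDiff_radVelQuot (by simpa using hvs t ht)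
  have hW3 : ContDiff ℝ 3 W := hWc.of_le (by norm_cast)
  have hW2 : ContDiff ℝ 2 W := hWc.of_le (by norm_cast)
  have hW1 : ContDiff ℝ 1 W := hWc.of_le (by norm_cast)
  have m1 : ∀ i : Fin 3, MemLp (fun x => fderiv ℝ W x (EuclideanSpace.single i 1)) 2 volume := fun i =>
    memLp_two_of_norm_le_coe (F := fun x => iteratedFDeriv ℝ 1 W x)
      ((hW1.continuous_fderiv one_ne_zero).clm_apply continuous_const)
      (fun x => norm_fderiv_apply_single_le_iteratedFDeriv W x i) (hC1 t ht)
  -- `∂ᵢW ∈ C²`, `∂ⱼ∂ᵢW ∈ C¹`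
  have hgi : ∀ i : Fin 3, ContDiff ℝ 2 fun y => fderiv ℝ W y (EuclideanSpace.single i 1) := fun i =>
    contDiff_fderiv_apply_const_succ (n := 2) (by exact_mod_cast hW3) _
  have hgij : ∀ i j : Fin 3, ContDiff ℝ 1 fun x => fderiv ℝ (fun y => fderiv ℝ W y
      (EuclideanSpace.single i 1)) x (EuclideanSpace.single j 1) := fun i j =>
    contDiff_fderiv_apply_const_succ (n := 1) (by exact_mod_cast hgi i) _
  have m2 : ∀ i j : Fin 3, MemLp (fun x => fderiv ℝ (fun y => fderiv ℝ W y (EuclideanSpace.single i 1)) x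
      (EuclideanSpace.single j 1)) 2 volume := fun i j =>
    memLp_two_of_norm_le_coe (F := fun x => iteratedFDeriv ℝ 2 W x) (hgij i j).continuous
      (fun x => norm_fderiv_fderiv_apply_single_le_iteratedFDeriv hW2 x i j) (hC2 t ht)
  have m3 : ∀ i j : Fin 3, MemLp (fun x => fderiv ℝ (fun y => fderiv ℝ (fun z => fderiv ℝ W z
      (EuclideanSpace.single i 1)) y (EuclideanSpace.single j 1)) x (EuclideanSpace.single j 1)) 2 volume :=
    fun i j =>
    memLp_two_of_norm_le_coe (F := fun x => iteratedFDeriv ℝ 3 W x)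
      (((hgij i j).continuous_fderiv one_ne_zero).clm_apply continuous_const)
      (fun x => norm_fderiv3_apply_single_le_iteratedFDeriv hW3 x i j j) (hC3 t ht)
  exact ⟨m1, m2, m3, (memLp_radDerivQuot_of_memLp hW2 (m2 0 0)).1,
    (memLp_radDerivQuot_of_memLp (hgi 2) (m3 2 0)).1⟩

end Data

end Literature.Analysis.FluidPDE
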